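import Summits.CriticalPhenomena.PercolationContinuityZ3.Theorems.PercNearOneGluingNoHeavyLowerTailSahiAllButTwoRowA
import Summits.CriticalPhenomena.PercolationContinuityZ3.Theorems.PercNearOneGluingNoHeavyLowerTailSahiAllButC

/-!
# `NoHeavyLowerTail` (crux stmt-CriticalPhenomena-4575), Sahi / Kahn positivity: ROW (a) OF THE THRESHOLD CERTIFICATE AT LEVEL `k − 2`
# FOR EVERY `k` (the slot "AT LEAST TWO OF k OPEN"), by COMPLEMENT DUALITY with the level-2 row, and the certificate for `Th₂ᵏ` with (a) discharged

Support file (cell `prim-l12`, seat P3, gen 23; `--supports stmt-CriticalPhenomena-4575`).  No `sorry`, no named facts, standard axioms.  Memo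
`run/shared/lean/prim/prim-l12/FROM-prim-l12-p3-g23-LEVEL-SPLIT.md` §3.

The generic bridge `…SahiAllButC.rhoCert_allBut` turns the threshold certificate `ρ_c = μ(· | exactly c closed)` of the pattern event
`allBut c k = Th_{k−c}^k` into Kahn's Conjecture 5 / Sahi's `C₃` for that first slot, given row (a) `Θ_c·D_c ≤ (Π + D_c)·e_c` at the odds and the
(TC) row `Ñ_c(K_𝒳,K_𝒵)(r) ≥ 0`.  `…SahiAllButTwoRowA` discharged (a) at `c = 2` for every `k` COEFFICIENTWISE (`coeff_Th1_mul_Dd_le`: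
`Θ₁·D ≤ Π·e₂`).  THIS FILE discharges (a) at the CO-level `c = k − 2` for every `k ≥ 3`: complementation `S ↦ V ∖ S` is a bijection between the
profile pairs counted by `Θ_{k−3}·D_{k−2}` resp. `Π·e_{k−2}` and those counted by `D·Θ₁` resp. `e₂·Π` at the complementary profile
(`card_pairs_colevel_le`, `card_pairs_two_le_colevel`; the maps `coPair_injective`, `coPair'_injective`), so `…SahiAllButTwo.card_pairs_rowA` gives `Θ_{k−3}·D_{k−2} ≤ Π·e_{k−2}` coefficientwise
(`coeff_ThC_mul_DdC_le_colevel`), i.e. row (a) `(Π + D_{k−2})·e_{k−2} − Θ_{k−2}·D_{k−2} ∈ ℕ[r]` (`coeff_aPoly_colevel_nonneg`, `aRow_colevel`).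
Consequently (`sahiE_three_nonneg_of_atLeastTwo_of_Ngen`, `…_of_coeff`): **for every `k ≥ 3`, Kahn C5 / Sahi C₃ for the first slot "at least two
of the `k` coordinates open" follows from the (TC) row ALONE** — `Ñ_{k−2}(K_𝒳,K_𝒵)(r) ≥ 0` at the odds, in particular from `Ñ_{k−2} ∈ ℕ[r]` for
every pair of complexes on `k` points (the level-`(k−2)` case of the lane's conjecture CTC / of the level split (LS) of `…SahiCTCNcSplit`).
Nothing is asserted about the crux.
-/

noncomputable section

open scoped Classical

namespace Summit.CriticalPhenomena.PercolationContinuityZ3.Theorems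

namespace SahiAllButC

open Finset MvPolynomial
open SahiHittingSlot SahiTransportCert SahiAllButOne SahiAllButTwo SahiCTCForms SahiCTCGenFun SahiCTCWeightedLYM
open Literature.Combinatorics.Sahi2008
open Literature.Probability.Percolation (DeterminedBy)
open Literature.Probability.Percolation.DecisionTree (ind)

section Coeff

variable {α : Type*} [DecidableEq α] [Fintype α]

omit [Fintype α] in
/-- `(V∖S) ∩ (V∖P) = V ∖ (P ∪ S)` and `(V∖S) ∪ (V∖P) = V ∖ (P ∩ S)`. [this work] -/
theorem coPair_inter_union (V P S : Finset α) :
    (V \ S) ∩ (V \ P) = V \ (P ∪ S) ∧ (V \ S) ∪ (V \ P) = V \ (P ∩ S) := by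
  constructor
  · ext x; simp only [mem_inter, mem_sdiff, mem_union]; tauto
  · ext x; simp only [mem_union, mem_sdiff, mem_inter]; tauto

/-- The complement-swap map `(P, S) ↦ (V ∖ S, V ∖ P)` is injective. [this work] -/
theorem coPair_injective : Function.Injective (fun PS : Finset α × Finset α => (univ \ PS.2, univ \ PS.1)) := by
  intro a b h
  have h1 : univ \ a.2 = univ \ b.2 := congrArg Prod.fst h
  have h2 : univ \ a.1 = univ \ b.1 := congrArg Prod.snd h
  have e1 : a.1 = b.1 := by
    rw [← Finset.sdiff_sdiff_eq_self (subset_univ a.1), h2, Finset.sdiff_sdiff_eq_self (subset_univ b.1)]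
  have e2 : a.2 = b.2 := by
    rw [← Finset.sdiff_sdiff_eq_self (subset_univ a.2), h1, Finset.sdiff_sdiff_eq_self (subset_univ b.2)]
  exact Prod.ext e1 e2

/-- The componentwise complement map `(P, S) ↦ (V ∖ P, V ∖ S)` is injective. [this work] -/
theorem coPair'_injective : Function.Injective (fun PS : Finset α × Finset α => (univ \ PS.1, univ \ PS.2)) := by
  intro a b h
  have h1 : univ \ a.1 = univ \ b.1 := congrArg Prod.fst h
  have h2 : univ \ a.2 = univ \ b.2 := congrArg Prod.snd h
  have e1 : a.1 = b.1 := by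
    rw [← Finset.sdiff_sdiff_eq_self (subset_univ a.1), h1, Finset.sdiff_sdiff_eq_self (subset_univ b.1)]
  have e2 : a.2 = b.2 := by
    rw [← Finset.sdiff_sdiff_eq_self (subset_univ a.2), h2, Finset.sdiff_sdiff_eq_self (subset_univ b.2)]
  exact Prod.ext e1 e2

/-- **Complement duality, first half**: `coPair` maps the pairs counted by `Θ_{k−3}·D_{k−2}` at the profile `(D, N)` into the pairs
counted by `Θ₁·D` at the complementary profile `(V∖N, V∖D)` (first component of size `≤ 1`, second of size `≥ 3`). [this work] -/
theorem card_pairs_colevel_le (D N : Finset α) (hK : 3 ≤ Fintype.card α) :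
    #(pairs (univ.powerset : Finset (Finset α)) D N (· ≤ Fintype.card α - 3) (Fintype.card α - 2 < ·)) ≤
      #(pairs (univ.powerset : Finset (Finset α)) (univ \ N) (univ \ D) (· ≤ 1) (3 ≤ ·)) := by
  refine card_le_card_of_injOn (fun PS : Finset α × Finset α => (univ \ PS.2, univ \ PS.1)) (fun PS hPS => ?_)
    (coPair_injective.injOn)
  rw [mem_coe, mem_pairs] at hPS ⊢
  obtain ⟨-, hI, hU, hP, hS⟩ := hPS
  obtain ⟨h1, h2⟩ := coPair_inter_union (univ : Finset α) PS.1 PS.2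
  have hS' : #PS.2 ≤ Fintype.card α := by rw [← card_univ]; exact card_le_card (subset_univ _)
  refine ⟨mem_powerset.2 (subset_univ _), ?_, ?_, ?_, ?_⟩
  · show (univ \ PS.2) ∩ (univ \ PS.1) = univ \ N
    rw [h1, hU]
  · show (univ \ PS.2) ∪ (univ \ PS.1) = univ \ D
    rw [h2, hI]
  · show #(univ \ PS.2) ≤ 1
    rw [card_univ_sdiff]; omega
  · show 3 ≤ #(univ \ PS.1)
    rw [card_univ_sdiff]; omega

/-- **Complement duality, second half**: `coPair` maps the pairs counted by `Π·e₂` at `(V∖N, V∖D)` into those counted by `Π·e_{k−2}` at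
`(D, N)`. [this work] -/
theorem card_pairs_two_le_colevel (D N : Finset α) :
    #(pairs (univ.powerset : Finset (Finset α)) (univ \ N) (univ \ D) (0 ≤ ·) (· = 2)) ≤
      #(pairs (univ.powerset : Finset (Finset α)) D N (0 ≤ ·) (· = Fintype.card α - 2)) := by
  refine card_le_card_of_injOn (fun PS : Finset α × Finset α => (univ \ PS.1, univ \ PS.2)) (fun QT hQT => ?_)
    (coPair'_injective.injOn)
  rw [mem_coe, mem_pairs] at hQT ⊢
  obtain ⟨-, hI, hU, -, hS⟩ := hQT
  obtain ⟨h1, h2⟩ := coPair_inter_union (univ : Finset α) QT.2 QT.1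
  refine ⟨mem_powerset.2 (subset_univ _), ?_, ?_, Nat.zero_le _, ?_⟩
  · show (univ \ QT.1) ∩ (univ \ QT.2) = D
    rw [h1, union_comm, hU, Finset.sdiff_sdiff_eq_self (subset_univ D)]
  · show (univ \ QT.1) ∪ (univ \ QT.2) = N
    rw [h2, inter_comm, hI, Finset.sdiff_sdiff_eq_self (subset_univ N)]
  · show #(univ \ QT.2) = Fintype.card α - 2
    rw [card_univ_sdiff, hS]

/-- **The pair count behind row (a) at level `k − 2`**: for `D ⊆ N` the pairs `(P, S)` with `P ∩ S = D`, `P ∪ S = N`, `#P ≤ k − 3`,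
`#S > k − 2` are at most as many as the pairs with `#S = k − 2` — by complement duality from `…SahiAllButTwo.card_pairs_rowA`. [this work] -/
theorem card_pairs_rowA_colevel (D N : Finset α) (hDN : D ⊆ N) (hK : 3 ≤ Fintype.card α) :
    #(pairs (univ.powerset : Finset (Finset α)) D N (· ≤ Fintype.card α - 3) (Fintype.card α - 2 < ·)) ≤
      #(pairs (univ.powerset : Finset (Finset α)) D N (0 ≤ ·) (· = Fintype.card α - 2)) :=
  (card_pairs_colevel_le D N hK).trans
    ((card_pairs_rowA (univ \ N) (univ \ D) (sdiff_subset_sdiff Subset.rfl hDN)).trans (card_pairs_two_le_colevel D N))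

/-- **Row (a) at level `k − 2`, core form: `Θ_{k−3}·D_{k−2} ≤ Π·e_{k−2}` coefficientwise** (`k = |α| ≥ 3`). [this work] -/
theorem coeff_ThC_mul_DdC_le_colevel (hK : 3 ≤ Fintype.card α) (n : α →₀ ℕ) :
    (ThC (Fintype.card α - 3) * DdC (Fintype.card α - 2) : MvPolynomial α ℤ).coeff n ≤
      (PiP * ee (Fintype.card α - 2) : MvPolynomial α ℤ).coeff n := by
  have hPi : (PiP : MvPolynomial α ℤ) = gf (univ.powerset.filter fun P : Finset α => 0 ≤ #P) := by
    unfold PiP; rw [filter_true_of_mem fun P _ => Nat.zero_le #P]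
  rw [hPi]
  unfold ThC DdC ee bySize
  rw [coeff_gf_mul_gf, coeff_gf_mul_gf]
  by_cases hn : ∀ i, n i ≤ 2
  · rw [filter_prod_eq_pairs _ (· ≤ Fintype.card α - 3) (Fintype.card α - 2 < ·) n hn,
      filter_prod_eq_pairs _ (0 ≤ ·) (· = Fintype.card α - 2) n hn]
    have hDN : dbl n ⊆ n.support := fun i hi => by unfold dbl at hi; exact (mem_filter.1 hi).1
    exact_mod_cast card_pairs_rowA_colevel (dbl n) n.support hDN hK
  · rw [filter_prod_eq_empty _ _ n hn, filter_prod_eq_empty _ _ n hn]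

/-- `Θ_{c+1} = Θ_c + e_{c+1}`. [this work] -/
theorem ThC_add_one_eq (c : ℕ) : (ThC (c + 1) : MvPolynomial α ℤ) = ThC c + ee (c + 1) := by
  unfold ThC ee bySize
  rw [← gf_union]
  · congr 1; ext C
    simp only [mem_union, mem_filter, mem_powerset, subset_univ, true_and]; omega
  · rw [disjoint_left]; intro C h1 h2
    have := (mem_filter.1 h1).2; have := (mem_filter.1 h2).2; omega

/-- **Row (a) at level `k − 2` coefficientwise: `(Π + D_{k−2})·e_{k−2} − Θ_{k−2}·D_{k−2} ∈ ℕ[r]`** (`k = |α| ≥ 3`). [this work] -/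
theorem coeff_aPoly_colevel_nonneg (hK : 3 ≤ Fintype.card α) (n : α →₀ ℕ) :
    0 ≤ ((PiP + DdC (Fintype.card α - 2)) * ee (Fintype.card α - 2) - ThC (Fintype.card α - 2) * DdC (Fintype.card α - 2) :
      MvPolynomial α ℤ).coeff n := by
  have hc : Fintype.card α - 2 = (Fintype.card α - 3) + 1 := by omega
  have hid : ((PiP + DdC (Fintype.card α - 2)) * ee (Fintype.card α - 2) - ThC (Fintype.card α - 2) * DdC (Fintype.card α - 2) :
      MvPolynomial α ℤ) = PiP * ee (Fintype.card α - 2) - ThC (Fintype.card α - 3) * DdC (Fintype.card α - 2) := by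
    conv_lhs => rw [hc]
    rw [ThC_add_one_eq, ← hc]; ring
  rw [hid, coeff_sub, sub_nonneg]
  exact coeff_ThC_mul_DdC_le_colevel hK n

end Coeff

/-! ### Row (a) at the odds vector and the certificate for "at least two of `k` open" with (a) discharged -/

variable {k : ℕ}

/-- **Row (a) at level `k − 2` at the odds vector of interior parameters, every `k ≥ 3`.** [this work] -/
theorem aRow_colevel {q : Fin k → unitInterval} (hq : ∀ i, 0 < (q i : ℝ) ∧ (q i : ℝ) < 1) (hk : 3 ≤ k) :
    ev q (ThC (k - 2)) * ev q (DdC (k - 2)) ≤ (ev q PiP + ev q (DdC (k - 2))) * ev q (ee (k - 2) : MvPolynomial (Fin k) ℤ) := by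
  have hK : 3 ≤ Fintype.card (Fin k) := by rw [Fintype.card_fin]; exact hk
  have h := eval_le_of_coeff_le (P := (0 : MvPolynomial (Fin k) ℤ))
    (Q := (PiP + DdC (k - 2)) * ee (k - 2) - ThC (k - 2) * DdC (k - 2))
    (fun m => by
      rw [coeff_zero]
      have := coeff_aPoly_colevel_nonneg (α := Fin k) hK m
      rwa [Fintype.card_fin] at this) (r q) (r_nonneg hq)
  rw [eval₂_zero, eval₂_sub, eval₂_mul, eval₂_mul, eval₂_add, sub_nonneg] at h
  exact h

/-- **THE CERTIFICATE FOR "AT LEAST TWO OF `k` OPEN", (a) DISCHARGED.**  For `k ≥ 3` and interior parameters: if `Ñ_{k−2}(K_𝒳,K_𝒵)(r) ≥ 0` for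
all nonempty up-sets `𝒳, 𝒵`, then `ρ_{k−2} = μ(· | exactly k − 2 closed) = μ(· | exactly two open)` is a reduced transport certificate of
`allBut (k−2) k = Th₂ᵏ`. [this work] -/
theorem rhoCert_atLeastTwo_of_Ngen {q : Fin k → unitInterval} (hq : ∀ i, 0 < (q i : ℝ) ∧ (q i : ℝ) < 1) (hk : 3 ≤ k)
    (hN : ∀ 𝒳 𝒵 : Set (Set (Fin k)), IsUpperSet 𝒳 → IsUpperSet 𝒵 → 𝒳.Nonempty → 𝒵.Nonempty → 0 ≤ ev q (Ngen (k - 2) (cx 𝒳) (cx 𝒵))) :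
    RhoCert q (allBut (k - 2) k) (rhoC q (k - 2)) :=
  rhoCert_allBut hq (by omega) (aRow_colevel hq hk) hN

/-- **KAHN'S CONJECTURE 5 / SAHI'S `C₃` FOR THE FIRST SLOT "AT LEAST TWO OF `k` OPEN", CONDITIONAL ONLY ON THE (TC) ROW.**  For a block
`e : Fin k ↪ ι` (`k ≥ 3`) with interior parameters, an increasing event `H` determined by the block with pattern event `allBut (k−2) k` (at
most `k − 2` of the `k` coordinates closed, i.e. at least two open), the hypothesis `Ñ_{k−2}(K_𝒳,K_𝒵)(r) ≥ 0` for all nonempty up-sets of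
patterns, and ALL increasing `U, V`: `E₃(1_H, 1_U, 1_V) ≥ 0`. [this work] -/
theorem sahiE_three_nonneg_of_atLeastTwo_of_Ngen {ι : Type} [Fintype ι] (p : ι → unitInterval) (e : Fin k ↪ ι) (hk : 3 ≤ k)
    (hp : ∀ i, 0 < (p (e i) : ℝ) ∧ (p (e i) : ℝ) < 1)
    (hN : ∀ 𝒳 𝒵 : Set (Set (Fin k)), IsUpperSet 𝒳 → IsUpperSet 𝒵 → 𝒳.Nonempty → 𝒵.Nonempty →
      0 ≤ ev (pk e p) (Ngen (k - 2) (cx 𝒳) (cx 𝒵)))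
    {H : Set (Set ι)} (hH : DeterminedBy H (Set.range e)) (hpat : pat e H = allBut (k - 2) k) {U V : Set (Set ι)} (hU : IsUpperSet U)
    (hV : IsUpperSet V) : 0 ≤ sahiE (bernoulliWeight p) 3 ![ind H, ind U, ind V] := by
  have hq : ∀ i, 0 < (pk e p i : ℝ) ∧ (pk e p i : ℝ) < 1 := hp
  exact sahiE_three_nonneg_of_allBut p e (c := k - 2) (by omega) hp (aRow_colevel hq hk) hN hH hpat hU hV

/-- **The same from the COEFFICIENTWISE hypothesis** `Ñ_{k−2}(K_X,K_Z) ∈ ℕ[r]` for every pair of complexes (down-sets containing `∅`) on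
`k` points — the level-`(k−2)` case of the lane's conjecture CTC, equivalently (by `…SahiCTCNcSplit.coeff_Ngen_nonneg_of_split`) of the
level-split conjecture (LS_{k−2}): `T_{k−2}, R_{k−2} ∈ ℕ[r]`. [this work] -/
theorem sahiE_three_nonneg_of_atLeastTwo_of_coeff {ι : Type} [Fintype ι] (p : ι → unitInterval) (e : Fin k ↪ ι) (hk : 3 ≤ k)
    (hp : ∀ i, 0 < (p (e i) : ℝ) ∧ (p (e i) : ℝ) < 1)
    (hC : ∀ KX KZ : Finset (Finset (Fin k)), IsLowerSet (KX : Set (Finset (Fin k))) → IsLowerSet (KZ : Set (Finset (Fin k))) →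
      ∅ ∈ KX → ∅ ∈ KZ → ∀ n, 0 ≤ (Ngen (k - 2) KX KZ).coeff n)
    {H : Set (Set ι)} (hH : DeterminedBy H (Set.range e)) (hpat : pat e H = allBut (k - 2) k) {U V : Set (Set ι)} (hU : IsUpperSet U)
    (hV : IsUpperSet V) : 0 ≤ sahiE (bernoulliWeight p) 3 ![ind H, ind U, ind V] := by
  have hq : ∀ i, 0 < (pk e p i : ℝ) ∧ (pk e p i : ℝ) < 1 := hp
  refine sahiE_three_nonneg_of_atLeastTwo_of_Ngen p e hk hp (fun 𝒳 𝒵 h𝒳 h𝒵 hX hZ => ?_) hH hpat hU hV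
  have h := eval_le_of_coeff_le (P := (0 : MvPolynomial (Fin k) ℤ)) (Q := Ngen (k - 2) (cx 𝒳) (cx 𝒵))
    (fun m => by rw [coeff_zero]; exact hC _ _ (isLowerSet_cx h𝒳) (isLowerSet_cx h𝒵) (empty_mem_cx h𝒳 hX) (empty_mem_cx h𝒵 hZ) m)
    (r (pk e p)) (r_nonneg hq)
  rw [eval₂_zero] at h
  exact h

end SahiAllButC

end Summit.CriticalPhenomena.PercolationContinuityZ3.Theorems
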